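import Summits.HodgeConjecture.HodgeConjecture.Theorems.F0P3GlobalPacketNValues                       -- ★ (LH7-p03) p847904: `SpectralPacketG.n_existsDisc_eq_half_of_unique` (+ ★ 3w `piXiHm`, ★ 3g `SpectralPacketH`)
import Summits.HodgeConjecture.HodgeConjecture.Theorems.F0P3SpectralPacketRigidityReduction            -- ★ (LH7-p03) p847962: `LocalPacketKit.eq_of_meet`, `mem_aTok_of_mem`, `GlobalPacket.eq_of_loc_eq`
import Summits.HodgeConjecture.HodgeConjecture.Theorems.F0P3SpectralPacketUnitarizableByOccurrence     -- ★ (LH7-p04) p848008: `SpectralPacketH.imageG_eq_of_isImageOf`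
import Summits.HodgeConjecture.HodgeConjecture.Theorems.F0P3SpectralPacketXiGermSums                   -- ★ (N) FILE 3t: `SpectralPacketH.XiRigidityH` (+ ★ 3r `XiHPacketsSigned`∕`rhoXiS`, ★ 3f `evpGψ`, ★ 3h `evpHψ`)
import HarnessLib

/-!
# «`n(Π(ξ)) = ½`» FROM THE LETTER՚S OWN `H`-RIGIDITY — the kit-generic core of ORGAN 4 `stub_PKvalueGOfRigidH : PKvalueGOfRigidHLetter` of the LH7 pay-down skeleton
# (Rogawski §13.3 Thm. 13.3.7 pp. 202–203, p. 203 «`Π̂(ξ) = {ξ} ∪ {1}`, `Card = 2`»; Thm. 13.3.4 p. 202; §13.1 Prop. 13.1.3 (d) p. 199; §13.2 p. 200 l. 1–3)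

Cell `hodgecm-mathlib`, F0∕P3c line LH7 (closer stub `stub_PKtuple : PKtupleLetter`, `Cruxes/H413/Lines/F0_U3LettersRung1.lean` ED. 38 «PK-ε», row #181),
crux H413 = `stmt-HodgeConjecture-24833`; organ payer LH7-p04 (g0), DEAL BY NAME (LH7-plan (g0) skeleton v1 `F0/P3c/LH7/LH7-plan/g0/StubPKtuple.paydown.skeleton.v1.lean`
+ `LH7-LINE.md` c2fdec8ceb42c5dc: «`stub_PKvalueGOfRigidH` — Holder: LH7-p04»).  `--supports stmt-HodgeConjecture-24833 --as helper`; proves no printed statement; never imports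
a `Cruxes/…/Lines` module (the organ՚s verbatim-prefix wrapper = short glue over this file inside the skeleton, T12-3 structure rule).

THE MATHEMATICS.  The (PK-A-G) row of the tuple letter has TWO conjuncts: rigidity of the ξ-shape on `G` (ORGAN 3) and the multiplicity VALUE
`n(Π(ξ)) = Card(Π̂(ξ))⁻¹ = ½` [Thm. 13.3.7; p. 203], `Π̂(ξ) = {ρ discrete : Π(ρ) = Π(ξ)} ∪ {1}`.  In the kit `n` is ★ `GlobalPacket.nRecip` relative to the predicate
«`σ` is the finite part of a `DiscH`-discrete `H`-packet» (the letter՚s shape `fun σ => ∃ P, DiscH σ P`, T-A :458), and ★ `n_existsDisc_eq_half_of_unique` (LH7-p03) reduces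
«`= ½`» to: (MEMBER) `Π(ξ)_f = Π(ρ(ξ))`, i.e. the token identity `ξ_H(ρ(ξ)_v) = Π(ξ)_v` at every finite `v`, and (UNIQUENESS) every discrete `σ` with `Π(σ) = Π(ξ)_f` is `ρ(ξ)_f`.
* (MEMBER) is kit law bookkeeping: `ξ_H(ρ(ξ)_v)` ((PK-SHAPE-H) ★ `IsSignedXiImageOf`) and `Π(ξ)_v` ((PK-SHAPE-G) ★ `IsSignedPacketOf`) have the same members `{πⁿ(ξ_v)} ∪ πˢ(ξ_v)`;
  both contain `πⁿ(ξ_v)`, so both are A-tokens by (KM2) [p. 199 ¶2 «`πⁿ(ξ_v)` lies in no L-packet»], hence both carry the signed ξ-shape by (KM3) [§13.2 p. 200 l. 1–3], hence are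
  EQUAL by (KM1)+(KJ-G) (★ `LocalPacketKit.eq_of_meet`, LH7-p03).
* (UNIQUENESS) is the letter՚s own `H`-rigidity clause ★ `XiRigidityH` [Thm. 13.3.5; (14.6.3) p. 243 «there exists a unique `ξ` …»] read at a LIFT: a discrete `σ` with
  `Π(σ) = Π(ξ)_f` lifts to a spectral `H`-packet `ρ′ = ⟨σ, P, ·, ·⟩` whose image `ρ′.imageG` IS `Π(ξ)_f` (★ `imageG_eq_of_isImageOf`), so its image e.v.p. `ρ′.evpHψ`
  (= `ρ′.imageG.evpAtψ` BY DEFINITION, ★ 3h) IS `Π(ξ).evpGψ` and `ramH ρ′ = ramG Π(ξ)`; the (P2a) facts for `Π(ξ)` — «`t(Π(ξ)) = t(ξ)` off `S`», «`ramG Π(ξ) ⊆ S`» (T-B :235∕:237,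
  ★ 3v `IsSignedPacketOf.evpGψ_eq_of_not_mem`∕`ramFinset_subset`; taken here as the hypothesis `hP2a`) — then put `ρ′` in the scope of `XiRigidityH`, which returns `ρ′ = ρ(ξ)`.
No sign VALUE is read (F10-neutral: the `pair`∕`ε` data enter only through the binder types of `hXiHS`).

CONTENTS (namespace ★ `…F0P3SpectralPacket`; 0 definitions; no instance, no notation, no named fact, no `sorry`):
* §1 `SpectralPacketH.xiH_rhoXiS_loc_eq_piXiHm_loc` (TOKEN IDENTITY from (KM1)∕(KJ-G)∕(KM2)∕(KM3)), `SpectralPacketG.isImageOf_piXiHm_rhoXiS`, `SpectralPacketH.imageG_rhoXiS_eq_piXiHm`.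
* §2 `SpectralPacketH.eq_rhoXiS_fin_of_isImageOf_of_xiRigidityH` (UNIQUENESS of the discrete preimage, from `XiRigidityH` + the (P2a) facts for `Π(ξ)`).
* §3 **`SpectralPacketG.piXiHm_n_existsDisc_eq_half_of_xiRigidityH`** ∕ `forall_piXiHm_n_existsDisc_eq_half_of_xiRigidityH` — ORGAN 4՚s conclusion
  `(piXiHm hXiS ξ).1.n (fun σ => ∃ P, DiscH σ P) = 1 / 2`, token for token, from the four marker rows, `hXiS`, `hXiHS`, `XiRigidityH` and `hP2a`.
HONEST LABEL: HC_CM is proved only modulo the 7 printed citations (2 remaining: hLiu418 = stmt-HodgeConjecture-24832, h413 = stmt-HodgeConjecture-24833) until rung 0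
closes; this file discharges the VALUE conjunct of (PK-A-G) relative to the letter՚s own rows and nothing else.

References: [Rogawski1990] §13.3 Thm. 13.3.4 p. 202, Thm. 13.3.5 p. 202, Thm. 13.3.7 pp. 202–203, p. 203; §13.1 p. 199, Prop. 13.1.3 (d) p. 199; §13.2 p. 200 l. 1–3;
§13.7 p. 206; §14.6 (14.6.1) p. 240, (14.6.3) p. 243.
-/

set_option autoImplicit false
-- the mandated namespace repeats `HodgeConjecture.HodgeConjecture`, as in every `Theorems/*.lean` of this sub-problem
set_option linter.dupNamespace false

noncomputable section

open NumberField IsDedekindDomain MeasureTheory Filter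
open scoped Matrix MatrixGroups

open Literature.NumberTheory Literature.NumberTheory.Automorphic Literature.NumberTheory.Automorphic.UnitaryGroup
open Literature.NumberTheory.Rogawski1990 Literature.NumberTheory.GaloisRepresentations
open Literature.RepresentationTheory.BorelWallach2000 Literature.RepresentationTheory.KonnoKonno2007
open Summit.HodgeConjecture.HodgeConjecture.Cruxes.H413.F0P3InnerFormClassificationV6 (splitForm EvpData EqOff)
open Summit.HodgeConjecture.HodgeConjecture.Cruxes.H413.F0P3LocalPacketKit
open Summit.HodgeConjecture.HodgeConjecture.Cruxes.H413.F0P3ArchPacketKit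
open Summit.HodgeConjecture.HodgeConjecture.Cruxes.H413.F0P3ArchPacketKit.ArchPacketKitH

namespace Summit.HodgeConjecture.HodgeConjecture.Cruxes.H413.F0P3SpectralPacket

open Summit.HodgeConjecture.HodgeConjecture.Cruxes.H413.F0P3GlobalPacket

/-! ## §1 TOKEN IDENTITY `ξ_H(ρ(ξ)_v) = Π(ξ)_v` from the marker rows [p. 199 ¶2; §13.2 p. 200 l. 1–3; Prop. 13.1.3 (d)] -/

section TokenIdentity

variable {L : Type} [Field L] [NumberField L] [IsCMField L] {H' : Matrix (Fin 3) (Fin 3) L}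
  {𝔩 : ∀ v : HeightOneSpectrum (𝓞 ↥(maximalRealSubfield L)), LocalPacketKit L H' v} {𝔞 : ArchPacketKit} {𝔞H : ArchPacketKitH 𝔞}
  {DiscH : GlobalPacketH 𝔩 → 𝔞H.PktInfH → Prop}
  {μ : Measure (adelicGroupData (↥(maximalRealSubfield L)) L (IsCMField.complexConj L) 3 H').automorphicQuotient}
  [SMulInvariantMeasure (adelicGroupData (↥(maximalRealSubfield L)) L (IsCMField.complexConj L) 3 H').Adelic
    (adelicGroupData (↥(maximalRealSubfield L)) L (IsCMField.complexConj L) 3 H').automorphicQuotient μ]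
  {infOf : GlobalPacket 𝔩 → 𝔞.PktInf} {aTok : ∀ v : HeightOneSpectrum (𝓞 ↥(maximalRealSubfield L)), Set (𝔩 v).Pkt}
  {Pk : OneDimAutRepH L → ∀ v : HeightOneSpectrum (𝓞 ↥(maximalRealSubfield L)), CMLocalAPacket L H' v}
  {PkInfG PkInfH : OneDimAutRepH L → LocalAPacket (GKIrrClass (uFormGroup (Fin 2) (Fin 1)))} {κ : OneDimAutRepH L → ℤ}
  {χ : OneDimAutRepH L → ∀ v : HeightOneSpectrum (𝓞 ↥(maximalRealSubfield L)),
    (UnitaryGroup.cmDatum L 2 (Matrix.of fun i j : Fin 2 => if i.val + j.val + 1 = 2 then (1 : L) else 0)).Local v ×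
      (UnitaryGroup.cmDatum L 1 (Matrix.of fun i j : Fin 1 => if i.val + j.val + 1 = 1 then (1 : L) else 0)).Local v →* ℂˣ}
  {hχ : ∀ (ξ : OneDimAutRepH L) (v : HeightOneSpectrum (𝓞 ↥(maximalRealSubfield L))),
    IsOpen (((χ ξ v).ker : Subgroup ((UnitaryGroup.cmDatum L 2 (Matrix.of fun i j : Fin 2 => if i.val + j.val + 1 = 2 then (1 : L) else 0)).Local v ×
      (UnitaryGroup.cmDatum L 1 (Matrix.of fun i j : Fin 1 => if i.val + j.val + 1 = 1 then (1 : L) else 0)).Local v)) :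
      Set ((UnitaryGroup.cmDatum L 2 (Matrix.of fun i j : Fin 2 => if i.val + j.val + 1 = 2 then (1 : L) else 0)).Local v ×
        (UnitaryGroup.cmDatum L 1 (Matrix.of fun i j : Fin 1 => if i.val + j.val + 1 = 1 then (1 : L) else 0)).Local v))}
  {ε : OneDimAutRepH L → HeightOneSpectrum (𝓞 ↥(maximalRealSubfield L)) → ℤ} {κH : OneDimAutRepH L → ℤ}

/-- **TOKEN IDENTITY `ξ_H(ρ(ξ)_v) = Π(ξ)_v`.**  Under the marker rows of `TupleKitLaws` at `v` — (KM1) token extensionality, (KJ-G) junk-zero signs, (KM2) «`πⁿ(ξ_v)` lies in no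
non-A token», (KM3) «an A-token meeting `Π(ξ_v)` IS the signed `Π(ξ_v)`» — the endoscopic image of the `v`-component of the (PK-SHAPE-H) witness `ρ(ξ) = rhoXiS hXiHS ξ` and the
`v`-component of the (PK-SHAPE-G) witness `Π(ξ) = (piXiHm hXiS ξ).1` are the SAME token: both have members `{πⁿ(ξ_v)} ∪ πˢ(ξ_v)` (★ `mem_xiH_rhoXiS_iff`, ★ `IsSignedPacketOf.mem_fin_iff`),
so both contain `πⁿ(ξ_v)` and are A-tokens ((KM2), ★ `mem_aTok_of_mem`; resp. ★ `piXiHm_mem_aTok`), and ★ `LocalPacketKit.eq_of_meet` ((KM3) then (KM1)+(KJ-G)) identifies them.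
[cite: Rogawski1990, §13.1 p. 199 ¶2, Prop. 13.1.3 (d) p. 199; §13.2 p. 200 l. 1–3; §13.3 Thm. 13.3.4 p. 202] -/
theorem SpectralPacketH.xiH_rhoXiS_loc_eq_piXiHm_loc
    (hKM1 : ∀ (v : HeightOneSpectrum (𝓞 ↥(maximalRealSubfield L))) (P P' : (𝔩 v).Pkt), (𝔩 v).mem P = (𝔩 v).mem P' → (∀ c, (𝔩 v).one P c = (𝔩 v).one P' c) →
      (P ∈ aTok v ↔ P' ∈ aTok v) → P = P')
    (hKJ : ∀ (v : HeightOneSpectrum (𝓞 ↥(maximalRealSubfield L))) (P : (𝔩 v).Pkt) (c : IrrClass ((UnitaryGroup.cmDatum L 3 H').Local v)),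
      c ∉ (𝔩 v).mem P → (𝔩 v).one P c = 0)
    (hKM2 : ∀ (ξ : OneDimAutRepH L) (v : HeightOneSpectrum (𝓞 ↥(maximalRealSubfield L))) (P : (𝔩 v).Pkt), P ∉ aTok v → (Pk ξ v).πn ∉ (𝔩 v).mem P)
    (hKM3 : ∀ (ξ : OneDimAutRepH L) (v : HeightOneSpectrum (𝓞 ↥(maximalRealSubfield L))) (P : (𝔩 v).Pkt), P ∈ aTok v →
      ((Pk ξ v).πn ∈ (𝔩 v).mem P ∨ ∃ c, (Pk ξ v).πs = some c ∧ c ∈ (𝔩 v).mem P) →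
      (∀ c, c ∈ (𝔩 v).mem P ↔ (c = (Pk ξ v).πn ∨ (Pk ξ v).πs = some c)) ∧ (𝔩 v).one P (Pk ξ v).πn = 1 ∧ ∀ c ∈ (𝔩 v).mem P, c ≠ (Pk ξ v).πn → (𝔩 v).one P c = -1)
    (hXiS : SpectralPacketG.XiPacketsSignedHom 𝔩 𝔞 μ infOf aTok Pk PkInfG κ) (hXiHS : SpectralPacketH.XiHPacketsSigned 𝔩 𝔞 𝔞H DiscH Pk PkInfH χ hχ ε κH)
    (ξ : OneDimAutRepH L) (v : HeightOneSpectrum (𝓞 ↥(maximalRealSubfield L))) :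
    (𝔩 v).xiH ((SpectralPacketH.rhoXiS hXiHS ξ).fin.loc v) = (SpectralPacketG.piXiHm hXiS ξ).1.fin.loc v := by
  have hnH : (Pk ξ v).πn ∈ (𝔩 v).mem ((𝔩 v).xiH ((SpectralPacketH.rhoXiS hXiHS ξ).fin.loc v)) :=
    (SpectralPacketH.mem_xiH_rhoXiS_iff hXiHS ξ v _).2 (Or.inl rfl)
  have hnG : (Pk ξ v).πn ∈ (𝔩 v).mem ((SpectralPacketG.piXiHm hXiS ξ).1.fin.loc v) :=
    ((SpectralPacketG.piXiHm_isSignedPacketOf hXiS ξ).mem_fin_iff v _).2 (Or.inl rfl)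
  exact (𝔩 v).eq_of_meet (aTok v) (hKM1 v) (hKJ v) (Pk ξ v) (hKM3 ξ v)
    ((𝔩 v).mem_aTok_of_mem (aTok v) (Pk ξ v) (hKM2 ξ v) hnH) (SpectralPacketG.piXiHm_mem_aTok hXiS ξ v) (Or.inl hnH) (Or.inl hnG)

/-- **(MEMBER) `Π(ξ)_f = Π(ρ(ξ))`**: the finite part of the (PK-SHAPE-G) witness is the `ξ_H`-image of the finite part of the (PK-SHAPE-H) witness (★ FILE 2 `IsImageOf`), under the four
marker rows. [cite: Rogawski1990, §13.3 Thm. 13.3.4 p. 202; §13.1 Prop. 13.1.3 (d) p. 199] -/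
theorem SpectralPacketG.isImageOf_piXiHm_rhoXiS
    (hKM1 : ∀ (v : HeightOneSpectrum (𝓞 ↥(maximalRealSubfield L))) (P P' : (𝔩 v).Pkt), (𝔩 v).mem P = (𝔩 v).mem P' → (∀ c, (𝔩 v).one P c = (𝔩 v).one P' c) →
      (P ∈ aTok v ↔ P' ∈ aTok v) → P = P')
    (hKJ : ∀ (v : HeightOneSpectrum (𝓞 ↥(maximalRealSubfield L))) (P : (𝔩 v).Pkt) (c : IrrClass ((UnitaryGroup.cmDatum L 3 H').Local v)),
      c ∉ (𝔩 v).mem P → (𝔩 v).one P c = 0)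
    (hKM2 : ∀ (ξ : OneDimAutRepH L) (v : HeightOneSpectrum (𝓞 ↥(maximalRealSubfield L))) (P : (𝔩 v).Pkt), P ∉ aTok v → (Pk ξ v).πn ∉ (𝔩 v).mem P)
    (hKM3 : ∀ (ξ : OneDimAutRepH L) (v : HeightOneSpectrum (𝓞 ↥(maximalRealSubfield L))) (P : (𝔩 v).Pkt), P ∈ aTok v →
      ((Pk ξ v).πn ∈ (𝔩 v).mem P ∨ ∃ c, (Pk ξ v).πs = some c ∧ c ∈ (𝔩 v).mem P) →
      (∀ c, c ∈ (𝔩 v).mem P ↔ (c = (Pk ξ v).πn ∨ (Pk ξ v).πs = some c)) ∧ (𝔩 v).one P (Pk ξ v).πn = 1 ∧ ∀ c ∈ (𝔩 v).mem P, c ≠ (Pk ξ v).πn → (𝔩 v).one P c = -1)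
    (hXiS : SpectralPacketG.XiPacketsSignedHom 𝔩 𝔞 μ infOf aTok Pk PkInfG κ) (hXiHS : SpectralPacketH.XiHPacketsSigned 𝔩 𝔞 𝔞H DiscH Pk PkInfH χ hχ ε κH)
    (ξ : OneDimAutRepH L) :
    (SpectralPacketG.piXiHm hXiS ξ).1.fin.IsImageOf (SpectralPacketH.rhoXiS hXiHS ξ).fin :=
  fun v => SpectralPacketH.xiH_rhoXiS_loc_eq_piXiHm_loc hKM1 hKJ hKM2 hKM3 hXiS hXiHS ξ v

/-- **`Π(ρ(ξ)) = Π(ξ)_f` as global packets** (`imageG` of the (PK-SHAPE-H) witness is the finite part of the (PK-SHAPE-G) witness), under the four marker rows.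
[cite: Rogawski1990, §13.3 Thm. 13.3.4 p. 202; §13.1 Prop. 13.1.3 (d) p. 199] -/
theorem SpectralPacketH.imageG_rhoXiS_eq_piXiHm
    (hKM1 : ∀ (v : HeightOneSpectrum (𝓞 ↥(maximalRealSubfield L))) (P P' : (𝔩 v).Pkt), (𝔩 v).mem P = (𝔩 v).mem P' → (∀ c, (𝔩 v).one P c = (𝔩 v).one P' c) →
      (P ∈ aTok v ↔ P' ∈ aTok v) → P = P')
    (hKJ : ∀ (v : HeightOneSpectrum (𝓞 ↥(maximalRealSubfield L))) (P : (𝔩 v).Pkt) (c : IrrClass ((UnitaryGroup.cmDatum L 3 H').Local v)),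
      c ∉ (𝔩 v).mem P → (𝔩 v).one P c = 0)
    (hKM2 : ∀ (ξ : OneDimAutRepH L) (v : HeightOneSpectrum (𝓞 ↥(maximalRealSubfield L))) (P : (𝔩 v).Pkt), P ∉ aTok v → (Pk ξ v).πn ∉ (𝔩 v).mem P)
    (hKM3 : ∀ (ξ : OneDimAutRepH L) (v : HeightOneSpectrum (𝓞 ↥(maximalRealSubfield L))) (P : (𝔩 v).Pkt), P ∈ aTok v →
      ((Pk ξ v).πn ∈ (𝔩 v).mem P ∨ ∃ c, (Pk ξ v).πs = some c ∧ c ∈ (𝔩 v).mem P) →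
      (∀ c, c ∈ (𝔩 v).mem P ↔ (c = (Pk ξ v).πn ∨ (Pk ξ v).πs = some c)) ∧ (𝔩 v).one P (Pk ξ v).πn = 1 ∧ ∀ c ∈ (𝔩 v).mem P, c ≠ (Pk ξ v).πn → (𝔩 v).one P c = -1)
    (hXiS : SpectralPacketG.XiPacketsSignedHom 𝔩 𝔞 μ infOf aTok Pk PkInfG κ) (hXiHS : SpectralPacketH.XiHPacketsSigned 𝔩 𝔞 𝔞H DiscH Pk PkInfH χ hχ ε κH)
    (ξ : OneDimAutRepH L) :
    (SpectralPacketH.rhoXiS hXiHS ξ).imageG = (SpectralPacketG.piXiHm hXiS ξ).1.fin :=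
  (SpectralPacketH.rhoXiS hXiHS ξ).imageG_eq_of_isImageOf (SpectralPacketG.isImageOf_piXiHm_rhoXiS hKM1 hKJ hKM2 hKM3 hXiS hXiHS ξ)

end TokenIdentity

/-! ## §2 UNIQUENESS of the discrete preimage from the letter՚s `H`-rigidity [Thm. 13.3.5; (14.6.3) p. 243] -/

section Uniqueness

variable {L : Type} [Field L] [NumberField L] [IsCMField L] {H : Matrix (Fin 3) (Fin 3) L}
  {𝔩 : ∀ v : HeightOneSpectrum (𝓞 ↥(maximalRealSubfield L)), LocalPacketKit L (splitForm L 3) v} {𝔞 : ArchPacketKit} {𝔞H : ArchPacketKitH 𝔞}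
  {DiscH : GlobalPacketH 𝔩 → 𝔞H.PktInfH → Prop}
  {μ : Measure (adelicGroupData (↥(maximalRealSubfield L)) L (IsCMField.complexConj L) 3 (splitForm L 3)).automorphicQuotient}
  [SMulInvariantMeasure (adelicGroupData (↥(maximalRealSubfield L)) L (IsCMField.complexConj L) 3 (splitForm L 3)).Adelic
    (adelicGroupData (↥(maximalRealSubfield L)) L (IsCMField.complexConj L) 3 (splitForm L 3)).automorphicQuotient μ]
  {infOf : GlobalPacket 𝔩 → 𝔞.PktInf} {aTok : ∀ v : HeightOneSpectrum (𝓞 ↥(maximalRealSubfield L)), Set (𝔩 v).Pkt}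
  {Pk : OneDimAutRepH L → ∀ v : HeightOneSpectrum (𝓞 ↥(maximalRealSubfield L)), CMLocalAPacket L (splitForm L 3) v}
  {PkInfG PkInfH : OneDimAutRepH L → LocalAPacket (GKIrrClass (uFormGroup (Fin 2) (Fin 1)))} {κ : OneDimAutRepH L → ℤ}
  {χ : OneDimAutRepH L → ∀ v : HeightOneSpectrum (𝓞 ↥(maximalRealSubfield L)),
    (UnitaryGroup.cmDatum L 2 (Matrix.of fun i j : Fin 2 => if i.val + j.val + 1 = 2 then (1 : L) else 0)).Local v ×
      (UnitaryGroup.cmDatum L 1 (Matrix.of fun i j : Fin 1 => if i.val + j.val + 1 = 1 then (1 : L) else 0)).Local v →* ℂˣ}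
  {hχ : ∀ (ξ : OneDimAutRepH L) (v : HeightOneSpectrum (𝓞 ↥(maximalRealSubfield L))),
    IsOpen (((χ ξ v).ker : Subgroup ((UnitaryGroup.cmDatum L 2 (Matrix.of fun i j : Fin 2 => if i.val + j.val + 1 = 2 then (1 : L) else 0)).Local v ×
      (UnitaryGroup.cmDatum L 1 (Matrix.of fun i j : Fin 1 => if i.val + j.val + 1 = 1 then (1 : L) else 0)).Local v)) :
      Set ((UnitaryGroup.cmDatum L 2 (Matrix.of fun i j : Fin 2 => if i.val + j.val + 1 = 2 then (1 : L) else 0)).Local v ×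
        (UnitaryGroup.cmDatum L 1 (Matrix.of fun i j : Fin 1 => if i.val + j.val + 1 = 1 then (1 : L) else 0)).Local v))}
  {ε : OneDimAutRepH L → HeightOneSpectrum (𝓞 ↥(maximalRealSubfield L)) → ℤ} {κH : OneDimAutRepH L → ℤ}
  {hXiHS : SpectralPacketH.XiHPacketsSigned 𝔩 𝔞 𝔞H DiscH Pk PkInfH χ hχ ε κH}
  {ψ : ∀ v : HeightOneSpectrum (𝓞 ↥(maximalRealSubfield L)), (cmDatum L 3 H).Local v ≃ₜ* (cmDatum L 3 (splitForm L 3)).Local v}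
  [∀ v : HeightOneSpectrum (𝓞 ↥(maximalRealSubfield L)), MeasurableSpace ((cmDatum L 3 (splitForm L 3)).Local v)]
  {νG : ∀ v : HeightOneSpectrum (𝓞 ↥(maximalRealSubfield L)), Measure ((cmDatum L 3 (splitForm L 3)).Local v)}
  {tXi : OneDimAutRepH L → EvpData L H}

/-- **A spectral `H`-packet whose image IS a given spectral `G`-packet՚s finite part has that packet՚s image e.v.p.**: `ρ.evpHψ ψ νG = Q.evpGψ ψ νG` (★ 3h: `evpHψ ρ := ρ.imageG.evpAtψ`,
`evpGψ Q = Q.fin.evpAtψ`, both `rfl`). [cite: Rogawski1990, §13.7 p. 206; §13.3 Thm. 13.3.4 p. 202] -/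
theorem SpectralPacketH.evpHψ_eq_evpGψ_of_imageG_eq (ρ : SpectralPacketH 𝔩 𝔞 𝔞H DiscH) (Q : SpectralPacketG 𝔩 𝔞 μ) (h : ρ.imageG = Q.fin) :
    ρ.evpHψ ψ νG = Q.evpGψ ψ νG := by
  funext v f
  show ρ.imageG.evpAtψ ψ νG v f = Q.fin.evpAtψ ψ νG v f
  rw [h]

omit [∀ v : HeightOneSpectrum (𝓞 ↥(maximalRealSubfield L)), MeasurableSpace ((cmDatum L 3 (splitForm L 3)).Local v)] in
/-- … and that packet՚s ramification set: `ramH ρ = ramG Q` (★ 3g: `ramFinsetH ρ := ρ.imageG.ramFinset`). [cite: Rogawski1990, §13.3 p. 199 ¶2, Thm. 13.3.4 p. 202] -/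
theorem SpectralPacketH.ramFinsetH_eq_of_imageG_eq (ρ : SpectralPacketH 𝔩 𝔞 𝔞H DiscH) (Q : SpectralPacketG 𝔩 𝔞 μ) (h : ρ.imageG = Q.fin) :
    ρ.ramFinsetH = Q.fin.ramFinset := by
  show ρ.imageG.ramFinset = Q.fin.ramFinset
  rw [h]

/-- **(UNIQUENESS) EVERY DISCRETE PREIMAGE OF `Π(ξ)_f` IS `ρ(ξ)_f`, from the letter՚s `H`-rigidity.**  Let `σ` be the finite part of a `DiscH`-discrete `H`-packet (`DiscH σ P`) with
`ξ_H(σ_v) = Π(ξ)_v` at every `v`.  The lift `ρ′ := ⟨σ, P, ·, ·⟩` is a spectral `H`-packet with `ρ′.imageG = Π(ξ)_f` (★ `imageG_eq_of_isImageOf`), so `evpH ρ′ = evpG Π(ξ)` and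
`ramH ρ′ = ramG Π(ξ)`; the (P2a) facts for `Π(ξ)` at a finite `S` («`t(Π(ξ)) = t(ξ)` off `S`, `ramG Π(ξ) ⊆ S`) put `ρ′` in the scope of `XiRigidityH` at `(ξ, S)`, which returns
`ρ′ = rhoXiS hXiHS ξ`; take finite parts. [cite: Rogawski1990, §13.3 Thm. 13.3.5 p. 202, Thm. 13.3.4 p. 202, p. 203; §14.6 (14.6.3) p. 243; §13.7 p. 206] -/
theorem SpectralPacketH.eq_rhoXiS_fin_of_isImageOf_of_xiRigidityH (hrigH : SpectralPacketH.XiRigidityH hXiHS ψ νG tXi)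
    (Q : SpectralPacketG 𝔩 𝔞 μ) (ξ : OneDimAutRepH L) (S : Finset (HeightOneSpectrum (𝓞 ↥(maximalRealSubfield L))))
    (hevp : EqOff L H S (Q.evpGψ ψ νG) (tXi ξ)) (hram : Q.fin.ramFinset ⊆ S)
    (σ : GlobalPacketH 𝔩) (hdisc : ∃ P : 𝔞H.PktInfH, DiscH σ P) (himg : Q.fin.IsImageOf σ) :
    σ = (SpectralPacketH.rhoXiS hXiHS ξ).fin := by
  obtain ⟨P, hP⟩ := hdisc
  have hcof : ∀ᶠ v : HeightOneSpectrum (𝓞 ↥(maximalRealSubfield L)) in cofinite, (𝔩 v).unr ((𝔩 v).xiH (σ.loc v)) :=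
    Q.fin.cofinite_unr.mono fun v hv => by rw [himg.xiH_loc_eq v]; exact hv
  let ρ' : SpectralPacketH 𝔩 𝔞 𝔞H DiscH := ⟨σ, P, hcof, hP⟩
  have himG : ρ'.imageG = Q.fin := ρ'.imageG_eq_of_isImageOf himg
  have hevp' : EqOff L H S (ρ'.evpHψ ψ νG) (tXi ξ) := by
    rw [ρ'.evpHψ_eq_evpGψ_of_imageG_eq Q himG]
    exact hevp
  have hram' : ρ'.ramFinsetH ⊆ S := by
    rw [ρ'.ramFinsetH_eq_of_imageG_eq Q himG]
    exact hram
  exact congrArg SpectralPacketH.fin (hrigH ξ S ρ' hevp' hram')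

end Uniqueness

/-! ## §3 ORGAN 4՚s conclusion: «`n(Π(ξ)) = ½`» in the letter՚s shape [Thm. 13.3.7; p. 203 `Card(Π̂(ξ)) = 2`] -/

section Value

variable {L : Type} [Field L] [NumberField L] [IsCMField L] {H : Matrix (Fin 3) (Fin 3) L}
  {𝔩 : ∀ v : HeightOneSpectrum (𝓞 ↥(maximalRealSubfield L)), LocalPacketKit L (splitForm L 3) v} {𝔞 : ArchPacketKit} {𝔞H : ArchPacketKitH 𝔞}
  {DiscH : GlobalPacketH 𝔩 → 𝔞H.PktInfH → Prop}
  {μ : Measure (adelicGroupData (↥(maximalRealSubfield L)) L (IsCMField.complexConj L) 3 (splitForm L 3)).automorphicQuotient}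
  [SMulInvariantMeasure (adelicGroupData (↥(maximalRealSubfield L)) L (IsCMField.complexConj L) 3 (splitForm L 3)).Adelic
    (adelicGroupData (↥(maximalRealSubfield L)) L (IsCMField.complexConj L) 3 (splitForm L 3)).automorphicQuotient μ]
  {infOf : GlobalPacket 𝔩 → 𝔞.PktInf} {aTok : ∀ v : HeightOneSpectrum (𝓞 ↥(maximalRealSubfield L)), Set (𝔩 v).Pkt}
  {Pk : OneDimAutRepH L → ∀ v : HeightOneSpectrum (𝓞 ↥(maximalRealSubfield L)), CMLocalAPacket L (splitForm L 3) v}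
  {PkInfG PkInfH : OneDimAutRepH L → LocalAPacket (GKIrrClass (uFormGroup (Fin 2) (Fin 1)))} {κ : OneDimAutRepH L → ℤ}
  {χ : OneDimAutRepH L → ∀ v : HeightOneSpectrum (𝓞 ↥(maximalRealSubfield L)),
    (UnitaryGroup.cmDatum L 2 (Matrix.of fun i j : Fin 2 => if i.val + j.val + 1 = 2 then (1 : L) else 0)).Local v ×
      (UnitaryGroup.cmDatum L 1 (Matrix.of fun i j : Fin 1 => if i.val + j.val + 1 = 1 then (1 : L) else 0)).Local v →* ℂˣ}
  {hχ : ∀ (ξ : OneDimAutRepH L) (v : HeightOneSpectrum (𝓞 ↥(maximalRealSubfield L))),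
    IsOpen (((χ ξ v).ker : Subgroup ((UnitaryGroup.cmDatum L 2 (Matrix.of fun i j : Fin 2 => if i.val + j.val + 1 = 2 then (1 : L) else 0)).Local v ×
      (UnitaryGroup.cmDatum L 1 (Matrix.of fun i j : Fin 1 => if i.val + j.val + 1 = 1 then (1 : L) else 0)).Local v)) :
      Set ((UnitaryGroup.cmDatum L 2 (Matrix.of fun i j : Fin 2 => if i.val + j.val + 1 = 2 then (1 : L) else 0)).Local v ×
        (UnitaryGroup.cmDatum L 1 (Matrix.of fun i j : Fin 1 => if i.val + j.val + 1 = 1 then (1 : L) else 0)).Local v))}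
  {ε : OneDimAutRepH L → HeightOneSpectrum (𝓞 ↥(maximalRealSubfield L)) → ℤ} {κH : OneDimAutRepH L → ℤ}
  {ψ : ∀ v : HeightOneSpectrum (𝓞 ↥(maximalRealSubfield L)), (cmDatum L 3 H).Local v ≃ₜ* (cmDatum L 3 (splitForm L 3)).Local v}
  [∀ v : HeightOneSpectrum (𝓞 ↥(maximalRealSubfield L)), MeasurableSpace ((cmDatum L 3 (splitForm L 3)).Local v)]
  {νG : ∀ v : HeightOneSpectrum (𝓞 ↥(maximalRealSubfield L)), Measure ((cmDatum L 3 (splitForm L 3)).Local v)}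
  {tXi : OneDimAutRepH L → EvpData L H}

/-- **ORGAN 4, KIT-GENERIC CORE — «`n(Π(ξ)) = ½`» FROM THE MARKER ROWS, THE TWO ξ-SHAPES, THE LETTER՚S `H`-RIGIDITY AND THE (P2a) FACTS FOR `Π(ξ)`.**  For the tuple՚s
`Π(ξ) := (piXiHm hXiS ξ).1` the letter՚s value clause `(piXiHm hXiS ξ).1.n (fun σ => ∃ P, DiscH σ P) = 1 / 2` (T-A `PKtupleLetter` :458, token for token) HOLDS, given: (KM1),
(KJ-G), (KM2), (KM3) of `TupleKitLaws` (texts verbatim, `Pk :=` the transported record); `hXiS` (PK-SHAPE-G) and `hXiHS` (PK-SHAPE-H) over the SAME finite A-packet data `Pk`; the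
letter՚s own `XiRigidityH hXiHS ψ νG tXi` ((PK-A-H), first conjunct); and, for this `ξ`, a finite `S` off which `t(Π(ξ)) = t(ξ)` (`EqOff`) with `ramG Π(ξ) ⊆ S` (the (P2a) facts, T-B
:235∕:237).  Proof: ★ `n_existsDisc_eq_half_of_unique` (LH7-p03) with (MEMBER) §1 and (UNIQUENESS) §2 — `Π̂(ξ) = {ξ} ∪ {1}`.
[cite: Rogawski1990, §13.3 Thm. 13.3.7 pp. 202–203, p. 203, Thm. 13.3.5 p. 202, Thm. 13.3.4 p. 202; §13.1 p. 199; §13.2 p. 200 l. 1–3; §14.6 (14.6.1) p. 240, (14.6.3) p. 243] -/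
theorem SpectralPacketG.piXiHm_n_existsDisc_eq_half_of_xiRigidityH
    (hKM1 : ∀ (v : HeightOneSpectrum (𝓞 ↥(maximalRealSubfield L))) (P P' : (𝔩 v).Pkt), (𝔩 v).mem P = (𝔩 v).mem P' → (∀ c, (𝔩 v).one P c = (𝔩 v).one P' c) →
      (P ∈ aTok v ↔ P' ∈ aTok v) → P = P')
    (hKJ : ∀ (v : HeightOneSpectrum (𝓞 ↥(maximalRealSubfield L))) (P : (𝔩 v).Pkt) (c : IrrClass ((UnitaryGroup.cmDatum L 3 (splitForm L 3)).Local v)),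
      c ∉ (𝔩 v).mem P → (𝔩 v).one P c = 0)
    (hKM2 : ∀ (ξ : OneDimAutRepH L) (v : HeightOneSpectrum (𝓞 ↥(maximalRealSubfield L))) (P : (𝔩 v).Pkt), P ∉ aTok v → (Pk ξ v).πn ∉ (𝔩 v).mem P)
    (hKM3 : ∀ (ξ : OneDimAutRepH L) (v : HeightOneSpectrum (𝓞 ↥(maximalRealSubfield L))) (P : (𝔩 v).Pkt), P ∈ aTok v →
      ((Pk ξ v).πn ∈ (𝔩 v).mem P ∨ ∃ c, (Pk ξ v).πs = some c ∧ c ∈ (𝔩 v).mem P) →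
      (∀ c, c ∈ (𝔩 v).mem P ↔ (c = (Pk ξ v).πn ∨ (Pk ξ v).πs = some c)) ∧ (𝔩 v).one P (Pk ξ v).πn = 1 ∧ ∀ c ∈ (𝔩 v).mem P, c ≠ (Pk ξ v).πn → (𝔩 v).one P c = -1)
    (hXiS : SpectralPacketG.XiPacketsSignedHom 𝔩 𝔞 μ infOf aTok Pk PkInfG κ) (hXiHS : SpectralPacketH.XiHPacketsSigned 𝔩 𝔞 𝔞H DiscH Pk PkInfH χ hχ ε κH)
    (hrigH : SpectralPacketH.XiRigidityH hXiHS ψ νG tXi) (ξ : OneDimAutRepH L)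
    (hP2a : ∃ S : Finset (HeightOneSpectrum (𝓞 ↥(maximalRealSubfield L))),
      EqOff L H S ((SpectralPacketG.piXiHm hXiS ξ).1.evpGψ ψ νG) (tXi ξ) ∧ (SpectralPacketG.piXiHm hXiS ξ).1.fin.ramFinset ⊆ S) :
    (SpectralPacketG.piXiHm hXiS ξ).1.n (fun σ => ∃ P : 𝔞H.PktInfH, DiscH σ P) = 1 / 2 := by
  obtain ⟨S, hevp, hram⟩ := hP2a
  exact (SpectralPacketG.piXiHm hXiS ξ).1.n_existsDisc_eq_half_of_unique (SpectralPacketH.rhoXiS hXiHS ξ)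
    (SpectralPacketG.isImageOf_piXiHm_rhoXiS hKM1 hKJ hKM2 hKM3 hXiS hXiHS ξ)
    (fun σ hdisc himg => SpectralPacketH.eq_rhoXiS_fin_of_isImageOf_of_xiRigidityH hrigH _ ξ S hevp hram σ hdisc himg)

/-- **ORGAN 4՚s conclusion for every `ξ`** (the letter՚s `∀ ξ, … = 1 / 2`), the (P2a) facts supplied per `ξ`. [cite: Rogawski1990, §13.3 Thm. 13.3.7 pp. 202–203, p. 203; §14.6 (14.6.1) p. 240] -/
theorem SpectralPacketG.forall_piXiHm_n_existsDisc_eq_half_of_xiRigidityH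
    (hKM1 : ∀ (v : HeightOneSpectrum (𝓞 ↥(maximalRealSubfield L))) (P P' : (𝔩 v).Pkt), (𝔩 v).mem P = (𝔩 v).mem P' → (∀ c, (𝔩 v).one P c = (𝔩 v).one P' c) →
      (P ∈ aTok v ↔ P' ∈ aTok v) → P = P')
    (hKJ : ∀ (v : HeightOneSpectrum (𝓞 ↥(maximalRealSubfield L))) (P : (𝔩 v).Pkt) (c : IrrClass ((UnitaryGroup.cmDatum L 3 (splitForm L 3)).Local v)),
      c ∉ (𝔩 v).mem P → (𝔩 v).one P c = 0)
    (hKM2 : ∀ (ξ : OneDimAutRepH L) (v : HeightOneSpectrum (𝓞 ↥(maximalRealSubfield L))) (P : (𝔩 v).Pkt), P ∉ aTok v → (Pk ξ v).πn ∉ (𝔩 v).mem P)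
    (hKM3 : ∀ (ξ : OneDimAutRepH L) (v : HeightOneSpectrum (𝓞 ↥(maximalRealSubfield L))) (P : (𝔩 v).Pkt), P ∈ aTok v →
      ((Pk ξ v).πn ∈ (𝔩 v).mem P ∨ ∃ c, (Pk ξ v).πs = some c ∧ c ∈ (𝔩 v).mem P) →
      (∀ c, c ∈ (𝔩 v).mem P ↔ (c = (Pk ξ v).πn ∨ (Pk ξ v).πs = some c)) ∧ (𝔩 v).one P (Pk ξ v).πn = 1 ∧ ∀ c ∈ (𝔩 v).mem P, c ≠ (Pk ξ v).πn → (𝔩 v).one P c = -1)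
    (hXiS : SpectralPacketG.XiPacketsSignedHom 𝔩 𝔞 μ infOf aTok Pk PkInfG κ) (hXiHS : SpectralPacketH.XiHPacketsSigned 𝔩 𝔞 𝔞H DiscH Pk PkInfH χ hχ ε κH)
    (hrigH : SpectralPacketH.XiRigidityH hXiHS ψ νG tXi)
    (hP2a : ∀ ξ : OneDimAutRepH L, ∃ S : Finset (HeightOneSpectrum (𝓞 ↥(maximalRealSubfield L))),
      EqOff L H S ((SpectralPacketG.piXiHm hXiS ξ).1.evpGψ ψ νG) (tXi ξ) ∧ (SpectralPacketG.piXiHm hXiS ξ).1.fin.ramFinset ⊆ S) :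
    ∀ ξ : OneDimAutRepH L, (SpectralPacketG.piXiHm hXiS ξ).1.n (fun σ => ∃ P : 𝔞H.PktInfH, DiscH σ P) = 1 / 2 :=
  fun ξ => SpectralPacketG.piXiHm_n_existsDisc_eq_half_of_xiRigidityH hKM1 hKJ hKM2 hKM3 hXiS hXiHS hrigH ξ (hP2a ξ)

end Value

end Summit.HodgeConjecture.HodgeConjecture.Cruxes.H413.F0P3SpectralPacket

end
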